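import Summits.ValiantsHypothesis.ValiantsHypothesis.Theorems.LacunarySymmetroidMatrixDescartesCensusChamber2141PosLeaf
import Summits.ValiantsHypothesis.ValiantsHypothesis.Theorems.LacunarySymmetroidMatrixDescartesCensusChamber2141NegLeaf
import Summits.ValiantsHypothesis.ValiantsHypothesis.Theorems.LacunarySymmetroidMatrixDescartesCensusChamberHalves

/-!
# `MatrixDescartes` census — chamber 2141: complete chamber-uniform door-A row from TWO magnitude certificates

HONEST FRAMING.  Object-search cell `pub-symmetroid`, door-A target `DoorA26 := PosRootLawAt 2 6 19`
(stmt-ValiantsHypothesis-19979; OPEN, typed, never asserted), crux `Theses.LacunarySymmetroid.MatrixDescartes`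
(stmt-ValiantsHypothesis-18050).  Chamber 2141 of theory g6's table (smallest member `(0,7,15,24,28,42)`, mirror 766;
words `DDIIDD` / `IIDDII`): BOTH `V = 20` cells are realised at sign level, and both are killed for every exponent vector
of the chamber by val-sym-door-p2 «NFLOW v4» certificates (`no_twenty_on_chamber2141_pos`, `no_twenty_on_chamber2141_neg`); the composition
`Census.posRootLawOn_of_chamber_halves` gives **`doorA26_on_chamber2141` — `PosRootLawOn 2 6 19 d` for EVERY `d` in the chamber**.
Nothing here bears on `V = 19`, on other chambers, on `DoorA26` as a whole (OPEN), on the crux, or on `VP ≠ VNP`.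

[folklore] Kernel replay of exact certificates (generated by the seat's `gen_cc.py`); elementary.
-/

-- `Summit.ValiantsHypothesis.ValiantsHypothesis.…` repeats a component by the D-0017 layout
-- (single-conjunct summit), which the `dupNamespace` linter flags; the name is mandated.
set_option linter.dupNamespace false

namespace Summit.ValiantsHypothesis.ValiantsHypothesis.Theorems.LacunarySymmetroidMatrixDescartes.Census

open Polynomial Finset
open scoped BigOperators Polynomial Matrix

/-- **DOOR-A ROW ON THE WHOLE CHAMBER 2141**: every exponent vector whose pair sums are ordered as in chamber 2141 (smallest member
`(0,7,15,24,28,42)`) satisfies `ζ(2,6; d) ≤ 19` — both orientations by NFLOW v4 magnitude certificates. [folklore] -/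
theorem doorA26_on_chamber2141 (d : Fin 6 → ℕ)
    (hd : StrictMono ((fun p : Fin 6 × Fin 6 => d p.1 + d p.2) ∘
      ![(0, 0), (0, 1), (1, 1), (0, 2), (1, 2), (0, 3), (0, 4), (2, 2), (1, 3), (1, 4), (2, 3),
        (0, 5), (2, 4), (3, 3), (1, 5), (3, 4), (4, 4), (2, 5), (3, 5), (4, 5), (5, 5)])) :
    PosRootLawOn 2 6 19 d :=
  posRootLawOn_of_chamber_halves _ 0 (by decide) (by decide) d hd
    (fun S hS hZ hs => no_twenty_on_chamber2141_pos d hd S hS hZ hs)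
    (fun S hS hZ hs => no_twenty_on_chamber2141_neg d hd S hS hZ hs)

/-- Non-vacuity: the smallest member of chamber 2141. [folklore] -/
example : PosRootLawOn 2 6 19 (![0, 7, 15, 24, 28, 42] : Fin 6 → ℕ) :=
  doorA26_on_chamber2141 _ (Fin.strictMono_iff_lt_succ.2 (by decide))

end Summit.ValiantsHypothesis.ValiantsHypothesis.Theorems.LacunarySymmetroidMatrixDescartes.Census
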